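import Literature.Probability.LatticeModels.LatticeGraph
import Mathlib.Order.Interval.Set.UnorderedInterval
import HarnessLib

/-!
# Unit-step trails in `ℤ^d` described by axis phases

Elementary bookkeeping for the lattice paths of the tree's proof of
`GarbanSpencer2022_xyLongRangeOrder` (Garban–Spencer, arXiv:2109.01617, Step 2 of the proof of
Theorem 1.3: paths in `ℤ^d` connecting `x` to `y` inside a ball).  A *phase list* is a list of
pairs `(l, δ)` — "move `|δ|` unit steps along the axis `l` in the direction `sign δ`";
`trail cur ph` is the list of lattice sites visited after the start `cur`.  We prove: consecutive
sites are nearest neighbours (`isChain_cons_trail`), the end point is `cur + disp ph`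
(`getLast_cons_trail`), coordinates of untouched axes do not move (`apply_eq_of_mem_trail`), each
coordinate stays between its initial and final value when the axes of the phases are distinct
(`apply_mem_uIcc_of_mem_trail`), the visited sites are then pairwise distinct and distinct from
`cur` (`nodup_cons_trail`), and `trail` is additive in the phase list (`trail_append`).
`edges L` lists the unordered nearest-neighbour edges of a site list.

Everything is [folklore]-level list manipulation; no probability appears.
-/

noncomputable section

open Finset
open scoped BigOperators

namespace Literature.Probability.LatticeModels

namespace Trail

variable {d : ℕ}

/-! ### Straight segments -/

/-- The `n` sites `cur + j s e_l`, `j = 1, …, n`, of a straight move with unit step `s e_l`.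
[folklore] -/
def segN (cur : Site d) (l : Fin d) (s : ℤ) : ℕ → List (Site d)
  | 0 => []
  | n + 1 => (cur + Pi.single l s) :: segN (cur + Pi.single l s) l s n

/-- `segN … 0 = []`. [folklore] -/
@[simp] theorem segN_zero (cur : Site d) (l : Fin d) (s : ℤ) : segN cur l s 0 = [] := rfl

/-- `segN … (n+1)`. [folklore] -/
@[simp] theorem segN_succ (cur : Site d) (l : Fin d) (s : ℤ) (n : ℕ) :
    segN cur l s (n + 1) = (cur + Pi.single l s) :: segN (cur + Pi.single l s) l s n := rfl

/-- The length of a segment. [folklore] -/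
@[simp] theorem length_segN (cur : Site d) (l : Fin d) (s : ℤ) (n : ℕ) : (segN cur l s n).length = n := by
  induction n generalizing cur with
  | zero => rfl
  | succ n ih => simp [ih]

/-- **Membership in a segment**: the sites are `cur + j s e_l`, `1 ≤ j ≤ n`. [folklore] -/
theorem mem_segN {cur : Site d} {l : Fin d} {s : ℤ} {n : ℕ} {w : Site d} :
    w ∈ segN cur l s n ↔ ∃ j : ℕ, 1 ≤ j ∧ j ≤ n ∧ w = cur + Pi.single l ((j : ℤ) * s) := by
  induction n generalizing cur with
  | zero => simp
  | succ n ih =>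
    rw [segN_succ, List.mem_cons, ih]
    constructor
    · rintro (rfl | ⟨j, hj1, hjn, rfl⟩)
      · exact ⟨1, le_rfl, by omega, by simp⟩
      · refine ⟨j + 1, by omega, by omega, ?_⟩
        rw [add_assoc, ← Pi.single_add]; congr 2; push_cast; ring
    · rintro ⟨j, hj1, hjn, rfl⟩
      rcases eq_or_lt_of_le hj1 with rfl | hj
      · left; simp
      · right
        refine ⟨j - 1, by omega, by omega, ?_⟩
        rw [add_assoc, ← Pi.single_add]; congr 2
        rw [Nat.cast_sub (by omega)]; push_cast; ring

/-- The last site of `cur :: segN cur l s n` is `cur + n s e_l`. [folklore] -/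
theorem getLast_cons_segN (cur : Site d) (l : Fin d) (s : ℤ) (n : ℕ) :
    (cur :: segN cur l s n).getLast (List.cons_ne_nil _ _) = cur + Pi.single l ((n : ℤ) * s) := by
  induction n generalizing cur with
  | zero => simp
  | succ n ih =>
    rw [segN_succ, List.getLast_cons (List.cons_ne_nil _ _), ih, add_assoc, ← Pi.single_add]
    congr 2; push_cast; ring

/-- Consecutive sites of a segment with unit step (`s = ±1`) are nearest neighbours. [folklore] -/
theorem isChain_cons_segN (cur : Site d) (l : Fin d) {s : ℤ} (hs : s = 1 ∨ s = -1) (n : ℕ) :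
    List.IsChain (zdGraph d).Adj (cur :: segN cur l s n) := by
  induction n generalizing cur with
  | zero => exact List.isChain_singleton _
  | succ n ih =>
    rw [segN_succ]
    refine List.IsChain.cons_cons ?_ (ih _)
    rw [zdGraph_adj_iff]
    refine ⟨l, ?_⟩
    rcases hs with rfl | rfl
    · exact Or.inl rfl
    · right; rw [add_assoc, ← Pi.single_add]; simp

/-! ### Trails -/

/-- The segment of a phase `(l, δ)`: `|δ|` unit steps of sign `sign δ` along `l`. [folklore] -/
def seg (cur : Site d) (l : Fin d) (δ : ℤ) : List (Site d) := segN cur l δ.sign δ.natAbs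

/-- The sites visited by the successive straight moves of a phase list, starting after `cur`.
[folklore] -/
def trail : Site d → List (Fin d × ℤ) → List (Site d)
  | _, [] => []
  | cur, (l, δ) :: rest => seg cur l δ ++ trail (cur + Pi.single l δ) rest

/-- The total displacement `∑ δ e_l` of a phase list. [folklore] -/
def disp : List (Fin d × ℤ) → Site d
  | [] => 0
  | (l, δ) :: rest => Pi.single l δ + disp rest

/-- `trail` of a cons. [folklore] -/
@[simp] theorem trail_cons (cur : Site d) (l : Fin d) (δ : ℤ) (rest : List (Fin d × ℤ)) :
    trail cur ((l, δ) :: rest) = seg cur l δ ++ trail (cur + Pi.single l δ) rest := rfl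

/-- `trail` of nil. [folklore] -/
@[simp] theorem trail_nil (cur : Site d) : trail cur [] = [] := rfl

/-- `disp` of a cons. [folklore] -/
@[simp] theorem disp_cons (l : Fin d) (δ : ℤ) (rest : List (Fin d × ℤ)) :
    disp ((l, δ) :: rest) = Pi.single l δ + disp rest := rfl

/-- `disp` of nil. [folklore] -/
@[simp] theorem disp_nil : disp ([] : List (Fin d × ℤ)) = 0 := rfl

/-- `disp` is additive. [folklore] -/
theorem disp_append (ph ph' : List (Fin d × ℤ)) : disp (ph ++ ph') = disp ph + disp ph' := by
  induction ph with
  | nil => simp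
  | cons p rest ih => obtain ⟨l, δ⟩ := p; simp [ih, add_assoc]

/-- A coordinate untouched by the phases has zero displacement. [folklore] -/
theorem disp_apply_of_not_mem {ph : List (Fin d × ℤ)} {l : Fin d} (h : l ∉ ph.map Prod.fst) :
    disp ph l = 0 := by
  induction ph with
  | nil => simp
  | cons p rest ih =>
    obtain ⟨l', δ⟩ := p
    simp only [List.map_cons, List.mem_cons, not_or] at h
    simp [h.1, ih h.2]

/-- The last site of `cur :: seg cur l δ` is `cur + δ e_l`. [folklore] -/
theorem getLast_cons_seg (cur : Site d) (l : Fin d) (δ : ℤ) :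
    (cur :: seg cur l δ).getLast (List.cons_ne_nil _ _) = cur + Pi.single l δ := by
  rw [seg, getLast_cons_segN, Int.natCast_natAbs, mul_comm, Int.sign_mul_abs]

/-- `sign δ = ±1` unless `δ = 0`. [folklore] -/
theorem sign_eq_or {δ : ℤ} (hδ : δ ≠ 0) : δ.sign = 1 ∨ δ.sign = -1 := by
  rcases lt_trichotomy δ 0 with h | h | h
  · exact Or.inr (Int.sign_eq_neg_one_of_neg h)
  · exact absurd h hδ
  · exact Or.inl (Int.sign_eq_one_of_pos h)

/-- Consecutive sites of `cur :: seg cur l δ` are nearest neighbours. [folklore] -/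
theorem isChain_cons_seg (cur : Site d) (l : Fin d) (δ : ℤ) :
    List.IsChain (zdGraph d).Adj (cur :: seg cur l δ) := by
  rcases eq_or_ne δ 0 with rfl | hδ
  · simp [seg]
  · exact isChain_cons_segN cur l (sign_eq_or hδ) _

/-- **`trail` is additive**: the trail of a concatenation is the first trail followed by the
trail of the rest from the displaced start. [folklore] -/
theorem trail_append (cur : Site d) (ph ph' : List (Fin d × ℤ)) :
    trail cur (ph ++ ph') = trail cur ph ++ trail (cur + disp ph) ph' := by
  induction ph generalizing cur with
  | nil => simp
  | cons p rest ih => obtain ⟨l, δ⟩ := p; simp [ih, add_assoc]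

/-- `getLast` through a junction: `(a :: (A ++ T)).getLast = T.getLast` for nonempty `T`.
[folklore] -/
theorem getLast_cons_append {α : Type*} (a : α) (A T : List α) (hT : T ≠ []) :
    (a :: (A ++ T)).getLast (List.cons_ne_nil _ _) = T.getLast hT := by
  show ((a :: A) ++ T).getLast (by simp) = _
  exact List.getLast_append_of_right_ne_nil _ _ hT

/-- **The end point of a trail**: the last site of `cur :: trail cur ph` is `cur + disp ph`.
[folklore] -/
theorem getLast_cons_trail (cur : Site d) (ph : List (Fin d × ℤ)) :
    (cur :: trail cur ph).getLast (List.cons_ne_nil _ _) = cur + disp ph := by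
  induction ph generalizing cur with
  | nil => simp
  | cons p rest ih =>
    obtain ⟨l, δ⟩ := p
    have e1 := getLast_cons_seg cur l δ
    have e2 := ih (cur + Pi.single l δ)
    by_cases h : trail (cur + Pi.single l δ) rest = []
    · simp only [h, List.getLast_singleton] at e2
      simp only [trail_cons, h, List.append_nil, disp_cons]
      rw [e1, ← add_assoc, ← e2]
    · rw [trail_cons, getLast_cons_append _ _ _ h, ← List.getLast_cons (a := cur + Pi.single l δ) h, e2,
        disp_cons, add_assoc]

/-- The head of a nonempty trail is a neighbour of the start. [folklore] -/
theorem isChain_cons_trail (cur : Site d) (ph : List (Fin d × ℤ)) :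
    List.IsChain (zdGraph d).Adj (cur :: trail cur ph) := by
  induction ph generalizing cur with
  | nil => exact List.isChain_singleton _
  | cons p rest ih =>
    obtain ⟨l, δ⟩ := p
    rw [trail_cons, ← List.cons_append]
    refine List.isChain_append.2 ⟨isChain_cons_seg cur l δ, (ih _).tail, ?_⟩
    intro a ha b hb
    rw [List.getLast?_eq_getLast_of_ne_nil (List.cons_ne_nil _ _), Option.mem_some_iff,
      getLast_cons_seg] at ha
    subst ha
    exact (List.isChain_cons.1 (ih (cur + Pi.single l δ))).1 b hb

/-! ### Coordinates along a trail -/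

/-- **Untouched coordinates do not move**: if the axis `l` does not occur in the phases, every
site of the trail has the same `l`-coordinate as the start. [folklore] -/
theorem apply_eq_of_mem_trail {cur : Site d} {ph : List (Fin d × ℤ)} {w : Site d} {l : Fin d}
    (hw : w ∈ trail cur ph) (hl : l ∉ ph.map Prod.fst) : w l = cur l := by
  induction ph generalizing cur with
  | nil => simp at hw
  | cons p rest ih =>
    obtain ⟨l', δ⟩ := p
    simp only [List.map_cons, List.mem_cons, not_or] at hl
    rw [trail_cons, List.mem_append] at hw
    rcases hw with hw | hw
    · rw [seg, mem_segN] at hw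
      obtain ⟨j, -, -, rfl⟩ := hw
      simp [hl.1]
    · rw [ih hw hl.2]
      simp [hl.1]

/-- **Coordinates stay between start and end** (distinct axes): for a phase list whose axes are
pairwise distinct, every coordinate of every site of the trail lies between its value at the start
and at the end point `cur + disp ph`. [folklore] -/
theorem apply_mem_uIcc_of_mem_trail {cur : Site d} {ph : List (Fin d × ℤ)}
    (hnd : (ph.map Prod.fst).Nodup) {w : Site d} (hw : w ∈ trail cur ph) (l : Fin d) :
    w l ∈ Set.uIcc (cur l) (cur l + disp ph l) := by
  induction ph generalizing cur with
  | nil => simp at hw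
  | cons p rest ih =>
    obtain ⟨l₀, δ⟩ := p
    simp only [List.map_cons, List.nodup_cons] at hnd
    have hrest : disp rest l₀ = 0 := disp_apply_of_not_mem hnd.1
    rw [trail_cons, List.mem_append] at hw
    rcases hw with hw | hw
    · rw [seg, mem_segN] at hw
      obtain ⟨j, hj1, hjn, rfl⟩ := hw
      by_cases hl : l = l₀
      · subst hl
        simp only [Pi.add_apply, Pi.single_eq_same, disp_cons, hrest, add_zero]
        -- `cur l + j sign δ ∈ [cur l, cur l + δ]`
        rcases eq_or_ne δ 0 with rfl | hδ
        · simp at hjn; omega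
        have hj : (j : ℤ) * δ.sign ∈ Set.uIcc (0 : ℤ) δ := by
          rcases sign_eq_or hδ with hs | hs
          · have hpos : 0 < δ := Int.sign_eq_one_iff_pos.1 hs
            rw [hs, mul_one, Set.uIcc_of_le hpos.le]
            refine ⟨by positivity, ?_⟩
            have : (j : ℤ) ≤ δ.natAbs := by exact_mod_cast hjn
            rwa [Int.natCast_natAbs, abs_of_pos hpos] at this
          · have hneg : δ < 0 := Int.sign_eq_neg_one_iff_neg.1 hs
            rw [hs, mul_neg_one, Set.uIcc_of_ge hneg.le]
            refine ⟨?_, by simp⟩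
            have : (j : ℤ) ≤ δ.natAbs := by exact_mod_cast hjn
            rw [Int.natCast_natAbs, abs_of_neg hneg] at this
            linarith
        rcases Set.mem_uIcc.1 hj with ⟨h1, h2⟩ | ⟨h1, h2⟩
        · exact Set.mem_uIcc.2 (Or.inl ⟨by linarith, by linarith⟩)
        · exact Set.mem_uIcc.2 (Or.inr ⟨by linarith, by linarith⟩)
      · simp [hl, Set.left_mem_uIcc]
    · have h := ih hnd.2 hw
      by_cases hl : l = l₀
      · subst hl
        simp only [Pi.add_apply, Pi.single_eq_same, hrest, add_zero, Set.uIcc_self,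
          Set.mem_singleton_iff] at h
        simp only [disp_cons, Pi.add_apply, Pi.single_eq_same, hrest, add_zero, h]
        exact Set.right_mem_uIcc
      · simp only [Pi.add_apply, Pi.single_apply, hl, if_false, add_zero] at h
        simpa [disp_cons, Pi.single_apply, hl] using h

/-! ### Distinctness -/

/-- **The sites of a trail with distinct axes are pairwise distinct and differ from the start.**
[folklore] -/
theorem nodup_cons_trail {cur : Site d} {ph : List (Fin d × ℤ)} (hnd : (ph.map Prod.fst).Nodup) :
    (cur :: trail cur ph).Nodup := by
  induction ph generalizing cur with
  | nil => simp
  | cons p rest ih =>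
    obtain ⟨l₀, δ⟩ := p
    simp only [List.map_cons, List.nodup_cons] at hnd
    have ih' := ih (cur := cur + Pi.single l₀ δ) hnd.2
    rcases eq_or_ne δ 0 with rfl | hδ
    · simpa [seg] using ih'
    -- coordinates along `l₀`: `cur + j sign δ` on the segment, `cur + δ` on the rest
    have hs : δ.sign ≠ 0 := fun h => hδ (Int.sign_eq_zero_iff_zero.1 h)
    have hT : ∀ w ∈ trail (cur + Pi.single l₀ δ) rest, w l₀ = cur l₀ + δ := fun w hw => by
      rw [apply_eq_of_mem_trail hw hnd.1]; simp
    have hsegco : ∀ w ∈ seg cur l₀ δ, ∃ j : ℕ, 1 ≤ j ∧ j ≤ δ.natAbs ∧ w l₀ = cur l₀ + j * δ.sign := by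
      intro w hw
      rw [seg, mem_segN] at hw
      obtain ⟨j, hj1, hjn, rfl⟩ := hw
      exact ⟨j, hj1, hjn, by simp⟩
    have hkey : ∀ j : ℕ, (j : ℤ) * δ.sign = δ → j = δ.natAbs := by
      intro j hj
      have := congrArg Int.natAbs hj
      rwa [Int.natAbs_mul, Int.natAbs_sign_of_ne_zero hδ, mul_one, Int.natAbs_natCast] at this
    rw [trail_cons, List.nodup_cons, List.mem_append, not_or, List.nodup_append]
    refine ⟨⟨fun h => ?_, fun h => ?_⟩, ?_, (List.nodup_cons.1 ih').2, ?_⟩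
    · obtain ⟨j, hj1, -, hco⟩ := hsegco cur h
      have : (j : ℤ) * δ.sign = 0 := by linarith
      rcases mul_eq_zero.1 this with h0 | h0
      · exact absurd (by exact_mod_cast h0 : j = 0) (by omega)
      · exact hs h0
    · have := hT cur h
      exact hδ (by linarith)
    · -- the segment is injective in `j`
      rw [seg]
      clear hsegco hT ih' ih
      suffices ∀ (c : Site d) (n : ℕ), (segN c l₀ δ.sign n).Nodup ∧
          ∀ w ∈ segN c l₀ δ.sign n, ∃ j : ℕ, 1 ≤ j ∧ w l₀ = c l₀ + j * δ.sign from (this cur _).1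
      intro c n
      induction n generalizing c with
      | zero => simp
      | succ n ihn =>
        obtain ⟨h1, h2⟩ := ihn (c + Pi.single l₀ δ.sign)
        refine ⟨List.nodup_cons.2 ⟨fun hmem => ?_, h1⟩, fun w hw => ?_⟩
        · obtain ⟨j, hj, hco⟩ := h2 _ hmem
          simp only [Pi.add_apply, Pi.single_eq_same] at hco
          have : (j : ℤ) * δ.sign = 0 := by linarith
          rcases mul_eq_zero.1 this with h0 | h0
          · exact absurd (by exact_mod_cast h0 : j = 0) (by omega)
          · exact hs h0
        · rw [segN_succ, List.mem_cons] at hw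
          rcases hw with rfl | hw
          · exact ⟨1, le_rfl, by simp⟩
          · obtain ⟨j, hj, hco⟩ := h2 w hw
            refine ⟨j + 1, by omega, ?_⟩
            simp only [Pi.add_apply, Pi.single_eq_same] at hco
            rw [hco]; push_cast; ring
    · -- segment and rest are disjoint: a common site has `l₀`-coordinate `cur + δ`, so it is the
      -- corner `cur + δ e_{l₀}`, which is not on the rest of the trail
      intro w hw w' hw' heq
      subst heq
      obtain ⟨j, hj1, hjn, hco⟩ := hsegco w hw
      have hco' := hT w hw'
      have hj : (j : ℤ) * δ.sign = δ := by linarith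
      have hjeq := hkey j hj
      rw [seg, mem_segN] at hw
      obtain ⟨j', -, -, rfl⟩ := hw
      simp only [Pi.add_apply, Pi.single_eq_same] at hco
      have : (j' : ℤ) * δ.sign = δ := by linarith
      have hw_eq : cur + Pi.single l₀ ((j' : ℤ) * δ.sign) = cur + Pi.single l₀ δ := by rw [this]
      rw [hw_eq] at hw'
      exact (List.nodup_cons.1 ih').1 hw'

/-! ### Edges of a site list -/

/-- The list of unordered edges `{L_k, L_{k+1}}` of a site list. [folklore] -/
def edges {α : Type*} : List α → List (Sym2 α)
  | [] => []
  | [_] => []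
  | a :: b :: rest => s(a, b) :: edges (b :: rest)

/-- `edges` of a list with at least two elements. [folklore] -/
@[simp] theorem edges_cons_cons {α : Type*} (a b : α) (rest : List α) :
    edges (a :: b :: rest) = s(a, b) :: edges (b :: rest) := rfl

/-- `edges` of short lists. [folklore] -/
@[simp] theorem edges_singleton {α : Type*} (a : α) : edges [a] = [] := rfl

/-- `edges [] = []`. [folklore] -/
@[simp] theorem edges_nil {α : Type*} : edges ([] : List α) = [] := rfl

/-- **Edges of a concatenation at a junction vertex.** [folklore] -/
theorem edges_append_cons {α : Type*} (L₁ : List α) (b : α) (L₂ : List α) :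
    edges (L₁ ++ b :: L₂) = edges (L₁ ++ [b]) ++ edges (b :: L₂) := by
  induction L₁ with
  | nil => simp
  | cons a rest ih =>
    cases rest with
    | nil => simp
    | cons a' rest' =>
      simp only [List.cons_append] at ih ⊢
      rw [edges_cons_cons, edges_cons_cons, ih, List.cons_append]

/-- Every endpoint of an edge of `L` is a member of `L`. [folklore] -/
theorem mem_of_mem_edges {α : Type*} {L : List α} {e : Sym2 α} (he : e ∈ edges L) {z : α}
    (hz : z ∈ e) : z ∈ L := by
  induction L with
  | nil => simp at he
  | cons a rest ih =>
    cases rest with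
    | nil => simp at he
    | cons b rest' =>
      rw [edges_cons_cons, List.mem_cons] at he
      rcases he with rfl | he
      · rcases Sym2.mem_iff.1 hz with rfl | rfl <;> simp
      · exact List.mem_cons_of_mem _ (ih he)

/-- The edges of `a :: M`: the first edge `{a, head M}` or an edge of `M`. [folklore] -/
theorem mem_edges_cons {α : Type*} {a : α} {M : List α} {e : Sym2 α} (he : e ∈ edges (a :: M)) :
    (∃ b, M.head? = some b ∧ e = s(a, b)) ∨ e ∈ edges M := by
  cases M with
  | nil => simp at he
  | cons b rest =>
    rw [edges_cons_cons, List.mem_cons] at he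
    rcases he with rfl | he
    · exact Or.inl ⟨b, rfl, rfl⟩
    · exact Or.inr he

/-- The number of edges is the number of sites minus one. [folklore] -/
theorem length_edges {α : Type*} (L : List α) : (edges L).length = L.length - 1 := by
  induction L with
  | nil => rfl
  | cons a rest ih =>
    cases rest with
    | nil => rfl
    | cons b rest' => simp only [edges_cons_cons, List.length_cons] at ih ⊢; omega

/-- The length of a trail is the total number of unit steps `∑ |δ|`. [folklore] -/
theorem length_trail (cur : Site d) (ph : List (Fin d × ℤ)) :
    (trail cur ph).length = (ph.map fun p => p.2.natAbs).sum := by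
  induction ph generalizing cur with
  | nil => simp
  | cons p rest ih => obtain ⟨l, δ⟩ := p; simp [seg, ih]

end Trail

end Literature.Probability.LatticeModels
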